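import Mathlib
import HarnessLib
import Summits.Ventures.LatticeQCDFlow.Exactness.ChargeSlabCorrelatorRP

/-!
# Reflection positivity makes the clover-ENERGY correlator NON-NEGATIVE across every reflection plane: `⟨(S_x − c)(S_{θx} − c)⟩ ≥ 0`, and the slab energies are positively correlated with their mirror images

HONEST FRAMING: exact (Metropolis-corrected) sampling algorithms for lattice gauge theory;
figures of merit are autocorrelation/cost numbers at stated couplings and volumes; no
continuum-physics claim.

Venture `LatticeQCDFlow` (cell pub-lqcd), topic `Exactness`, FANOUT row 21 (`su3-base`: the second scored observable of the
row is the clover energy — `t²E` after flow — whose slab sums and profiles the open-boundary arm also reads).  NEW WORK of the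
cell, def-free, the `0⁺⁺` companion of row 21's `Exactness/ChargeSlabCorrelatorRP` (the `0⁻⁺` clover CHARGE density is ODD
under the time reflections, so its correlator across a reflection plane is `≤ 0`): the bare clover ENERGY density
`S_x = Σ_{μ<ν} ‖C_{μν}(x)‖²` is EVEN (`CloverPseudoscalarParity.flowedCloverEnergy_zero_reflect`), so Osterwalder–Seiler
positivity gives the opposite sign — POSITIVE correlation of every centred energy observable with its mirror image.  Same
support lemmas (the clover at time `m` lives on the slices `m − 1, m, m + 1`), same Literature reflection positivity
(`FariaDaVeigaOCarroll2022.integral_mul_timeReflect_nonneg`, `β ≥ 0`, link plane; `integral_mul_negReflect_nonneg`, every `β`,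
site plane).  Nothing is cited as a fact; no number.  Printed mechanism NAMED ONLY: Osterwalder–Seiler 1978 / Seiler LNP 159
(reflection positivity ⇒ positivity of `⟨F·ΘF⟩` for half-space observables).

* §1 `flowedCloverEnergy_timeReflect` / `flowedCloverEnergy_negReflect` (`S_x(ΘU) = S_{θx}(U)`), `flowedCloverEnergy_congr_planes`,
  **`dependsOn_flowedCloverEnergy_posEdges`** (`2 ≤ x₀ ≤ L/2 − 1`), **`dependsOn_flowedCloverEnergy_sitePosEdges`**
  (`1 ≤ x₀ ≤ L/2 − 1`).
* §2 **`integral_sumEnergy_sub_mul_sum_timeReflect_nonneg`** / **`…_negReflect_nonneg`** — for every finite real combination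
  `F = Σ_k c_k S_{y_k} − a` of energy densities supported in the positive half, shifted by any constant `a`:
  `0 ≤ ∫ F · (Σ_k c_k S_{θ y_k} − a) dμ_β`; singletons **`integral_energy_sub_mul_timeReflect_nonneg`**
  (`⟨(S_x − c)(S_{θx} − c)⟩_β ≥ 0`, `β ≥ 0`) and **`integral_energy_sub_mul_negReflect_nonneg`** (every `β`).
* §3 SLAB ENERGIES `E_t = Σ_{x : x₀ = t} S_x`: **`integral_slabEnergy_sub_mul_timeReflect_nonneg`**
  (`⟨(E_m − c)(E_{1−m} − c)⟩_β ≥ 0`, `2 ≤ m ≤ L/2 − 1`, `β ≥ 0`) and **`integral_slabEnergy_sub_mul_negReflect_nonneg`**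
  (`⟨(E_m − c)(E_{−m} − c)⟩_β ≥ 0`, `1 ≤ m ≤ L/2 − 1`, every `β`) — with `c = ⟨E_m⟩` these are the connected slab-energy
  correlators at the reflected separations: NON-NEGATIVE.
* §4 THE SCHWARZ INEQUALITY of the OS form (Literature `MultiReflection.sq_integral_mul_comp_le_of_rp`):
  **`sq_integral_slabEnergy_sub_timeReflect_le`** (`(∫(E_m − c)(E_{1−m'} − c))² ≤ (∫(E_m − c)(E_{1−m} − c))·(∫(E_{m'} − c)(E_{1−m'} − c))`,
  `β ≥ 0`) and **`sq_integral_slabEnergy_sub_negReflect_le`** (site plane, every `β`): with `c = ⟨E⟩` the connected slab-energy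
  correlator is midpoint log-convex along either parity class of separations (the plaquette analogue is row 30's
  `Scaling/PlaquetteCorrelatorLogConvex`).
NOT CLAIMED: monotonicity in the separation (needs decay, an infinite-volume input); the flowed energy `t²E` (smoothing
footprint); spatial separations; numbers.
-/

noncomputable section

namespace Summit.Ventures.LatticeQCDFlow.Exactness

open MeasureTheory
open Literature.MathematicalPhysics.QuantumFieldTheory
open Literature.MathematicalPhysics.QuantumLattice (flowedClover flowedCloverEnergy flowedCloverEnergy_zero_reflect
  continuous_flowedCloverEnergy_zero measurable_flowedCloverEnergy_zero exists_abs_flowedCloverEnergy_zero_le cloverEdges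
  flowedClover_zero_congr)

/-! ## §1 The energy density is even under both reflections; support -/

section Reflections

variable {L N : ℕ} {G : Type*} [Group G] (ρ : G →* Matrix (Fin N) (Fin N) ℂ)

/-- **`S_x(ΘU) = S_{θx}(U)`**: the clover energy density is EVEN under the link reflection (unitary `ρ`). -/
theorem flowedCloverEnergy_timeReflect (hρ : ∀ g, ρ g ∈ Matrix.unitaryGroup (Fin N) ℂ) (U : GaugeConfig 4 L G)
    (x : Site 4 L) : flowedCloverEnergy ρ 0 x U.timeReflect = flowedCloverEnergy ρ 0 (Site.timeReflect x) U :=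
  flowedCloverEnergy_zero_reflect ρ hρ (Site.timeReflect (d := 4) (L := L)) (timeReflect_add_single_zero (L := L))
    (fun y _ hi => timeReflect_add_single_of_ne (L := L) y hi) U U.timeReflect
    (fun y => by unfold GaugeConfig.timeReflect; rw [if_pos rfl]; rfl)
    (fun y _ hi => by unfold GaugeConfig.timeReflect; rw [if_neg hi]) x

/-- **`S_x(Θ'U) = S_{θ'x}(U)`**: the clover energy density is EVEN under the site reflection. -/
theorem flowedCloverEnergy_negReflect (hρ : ∀ g, ρ g ∈ Matrix.unitaryGroup (Fin N) ℂ) (U : GaugeConfig 4 L G)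
    (x : Site 4 L) : flowedCloverEnergy ρ 0 x U.negReflect = flowedCloverEnergy ρ 0 (Site.negReflect x) U :=
  flowedCloverEnergy_zero_reflect ρ hρ (Site.negReflect (d := 4) (L := L)) (negReflect_add_single_zero (L := L))
    (fun y _ hi => negReflect_add_single_of_ne (L := L) y hi) U U.negReflect
    (fun y => by unfold GaugeConfig.negReflect; rw [if_pos rfl]; rfl)
    (fun y _ hi => by unfold GaugeConfig.negReflect; rw [if_neg hi]) x

/-- `S_x` depends only on the links of the six plane clovers through `x`: planes `(0, i)` and `(i, j)`, `i, j ≠ 0`. -/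
theorem flowedCloverEnergy_congr_planes {U V : GaugeConfig 4 L G} {x : Site 4 L}
    (h0 : ∀ i : Fin 4, i ≠ 0 → ∀ e ∈ cloverEdges x 0 i, U e = V e)
    (hs : ∀ i j : Fin 4, i ≠ 0 → j ≠ 0 → i ≠ j → ∀ e ∈ cloverEdges x i j, U e = V e) :
    flowedCloverEnergy ρ 0 x U = flowedCloverEnergy ρ 0 x V := by
  unfold flowedCloverEnergy
  refine Finset.sum_congr rfl fun μ _ => Finset.sum_congr rfl fun ν _ => ?_
  split_ifs with hμν
  · have hC : flowedClover ρ 0 U x μ ν = flowedClover ρ 0 V x μ ν := by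
      by_cases hμ : μ = 0
      · subst hμ
        exact flowedClover_zero_congr ρ (h0 ν (ne_of_gt hμν))
      · exact flowedClover_zero_congr ρ (hs μ ν hμ (fun h => by subst h; exact absurd hμν (by simp)) (ne_of_lt hμν))
    rw [hC]
  · rfl

/-- **`S_x` at time `m`, `2 ≤ m ≤ L/2 − 1`, is an observable of the positive-time links** of the link reflection. -/
theorem dependsOn_flowedCloverEnergy_posEdges [NeZero L] (x : Site 4 L) {m : ℕ} (hx : x 0 = m) (h2 : 2 ≤ m)
    (hm : m + 1 ≤ L / 2) (hL : m + 1 < L) :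
    DependsOn (fun U : GaugeConfig 4 L G => flowedCloverEnergy ρ 0 x U) {e : Edge 4 L | WilsonRP.IsPosEdge e} := by
  intro U V hUV
  refine flowedCloverEnergy_congr_planes ρ (fun i hi e he => hUV e ?_) (fun i j hi hj hij e he => hUV e ?_)
  · obtain ⟨hb, -, hf⟩ := cloverEdges_zero_time_mem x hi he
    obtain ⟨hb1, hb2⟩ := val_mem_slices hx (by omega) hL hb
    obtain ⟨hf1, hf2⟩ := val_mem_slices hx (by omega) hL hf
    exact ⟨by omega, by omega, by omega, by omega⟩
  · obtain ⟨hb, -, hf⟩ := cloverEdges_spatial_time_eq x hi hj he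
    obtain ⟨-, hv, -⟩ := val_slices hx (by omega) hL
    refine ⟨?_, ?_, ?_, ?_⟩ <;> simp only [hb, hf, hv] <;> omega

/-- **`S_x` at time `m`, `1 ≤ m ≤ L/2 − 1`, is an observable of the site-positive and shared links** of the site reflection. -/
theorem dependsOn_flowedCloverEnergy_sitePosEdges [NeZero L] (x : Site 4 L) {m : ℕ} (hx : x 0 = m) (h1 : 1 ≤ m)
    (hm : m + 1 ≤ L / 2) (hL : m + 1 < L) :
    DependsOn (fun U : GaugeConfig 4 L G => flowedCloverEnergy ρ 0 x U)
      ((WilsonSiteRP.sitePosEdges ∪ WilsonSiteRP.sharedEdges : Finset (Edge 4 L)) : Set (Edge 4 L)) := by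
  intro U V hUV
  refine flowedCloverEnergy_congr_planes ρ (fun i hi e he => hUV e ?_) (fun i j hi hj hij e he => hUV e ?_)
  · obtain ⟨hb, ht, -⟩ := cloverEdges_zero_time_mem x hi he
    simp only [Finset.coe_union, Set.mem_union, Finset.mem_coe, WilsonSiteRP.mem_sitePosEdges,
      WilsonSiteRP.mem_sharedEdges, WilsonSiteRP.IsSitePosEdge, WilsonSiteRP.IsSharedEdge]
    obtain ⟨hva, hvb, -⟩ := val_slices hx h1 hL
    by_cases he0 : e.2 = 0
    · have h2 := ht he0
      simp only [Finset.mem_insert, Finset.mem_singleton] at h2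
      left; rw [if_pos he0]; rcases h2 with h2 | h2 <;> [rw [h2, hva]; rw [h2, hvb]] <;> omega
    · obtain ⟨hb1, hb2⟩ := val_mem_slices hx h1 hL hb
      rw [if_neg he0]
      by_cases hlo : (e.1 0).val = 0
      · right; exact ⟨he0, Or.inl hlo⟩
      by_cases hhi : (e.1 0).val = L / 2
      · right; exact ⟨he0, Or.inr hhi⟩
      · left; omega
  · obtain ⟨hb, hne, -⟩ := cloverEdges_spatial_time_eq x hi hj he
    obtain ⟨-, hv, -⟩ := val_slices hx h1 hL
    simp only [Finset.coe_union, Set.mem_union, Finset.mem_coe, WilsonSiteRP.mem_sitePosEdges,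
      WilsonSiteRP.mem_sharedEdges, WilsonSiteRP.IsSitePosEdge, WilsonSiteRP.IsSharedEdge]
    left; rw [if_neg hne, hb, hv]; omega

end Reflections

/-! ## §2 Reflection positivity: centred energy observables correlate non-negatively with their mirror images -/

section Positivity

variable {L N : ℕ} [NeZero L] [Fact (1 < L)] {G : Type*} [Group G] [TopologicalSpace G] [IsTopologicalGroup G]
  [CompactSpace G] [MeasurableSpace G] [BorelSpace G] [SecondCountableTopology G]
  (ρ : G →* Matrix (Fin N) (Fin N) ℂ)

omit [Fact (1 < L)] [IsTopologicalGroup G] in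
/-- A finite real combination of energy densities, shifted by a constant, is measurable and bounded. -/
theorem measurable_bounded_sum_energy_sub (hρc : Continuous ρ) {ι : Type*} (s : Finset ι) (c : ι → ℝ) (a : ℝ)
    (y : ι → Site 4 L) :
    Measurable (fun U : GaugeConfig 4 L G => (∑ k ∈ s, c k * flowedCloverEnergy ρ 0 (y k) U) - a) ∧
      ∃ K : ℝ, ∀ U : GaugeConfig 4 L G, |(∑ k ∈ s, c k * flowedCloverEnergy ρ 0 (y k) U) - a| ≤ K := by
  refine ⟨(Finset.measurable_sum s fun k _ =>
    (measurable_flowedCloverEnergy_zero ρ hρc (y k)).const_mul (c k)).sub measurable_const, ?_⟩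
  choose C hC using fun k => exists_abs_flowedCloverEnergy_zero_le ρ hρc (R := ZMod L) (y k)
  refine ⟨(∑ k ∈ s, |c k| * C k) + |a|, fun U => (abs_sub _ _).trans ?_⟩
  gcongr
  refine (Finset.abs_sum_le_sum_abs _ _).trans (Finset.sum_le_sum fun k _ => ?_)
  rw [abs_mul]
  exact mul_le_mul_of_nonneg_left (hC k U) (abs_nonneg _)

/-- **LINK REFLECTION POSITIVITY FOR ENERGY DENSITIES** (even `L`, `β ≥ 0`, continuous unitary `ρ`): for every finite real
combination `F = Σ_k c_k S_{y_k} − a` at sites of times `2 ≤ (y_k)₀ ≤ L/2 − 1` and every constant `a`,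
`0 ≤ ∫ F · (Σ_k c_k S_{θ y_k} − a) dμ_β` (the OS form `⟨F·ΘF⟩ ≥ 0` with `ΘS = S∘θ`). -/
theorem integral_sumEnergy_sub_mul_sum_timeReflect_nonneg (hL : Even L) (hρc : Continuous ρ)
    (hρu : ∀ g, ρ g ∈ Matrix.unitaryGroup (Fin N) ℂ) {β : ℝ} (hβ : 0 ≤ β) {ι : Type*} (s : Finset ι) (c : ι → ℝ) (a : ℝ)
    (y : ι → Site 4 L) (hy : ∀ k ∈ s, ∃ m : ℕ, y k 0 = m ∧ 2 ≤ m ∧ m + 1 ≤ L / 2) :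
    0 ≤ ∫ U, ((∑ k ∈ s, c k * flowedCloverEnergy ρ 0 (y k) U) - a) *
        ((∑ k ∈ s, c k * flowedCloverEnergy ρ 0 (Site.timeReflect (y k)) U) - a) ∂(wilsonMeasure ρ β) := by
  have hL1 : 1 < L := Fact.out
  obtain ⟨hFm, hFb⟩ := measurable_bounded_sum_energy_sub ρ hρc s c a y
  have hFdep : DependsOn (fun U : GaugeConfig 4 L G => (∑ k ∈ s, c k * flowedCloverEnergy ρ 0 (y k) U) - a)
      {e : Edge 4 L | WilsonRP.IsPosEdge e} := by
    intro U V hUV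
    simp only [sub_left_inj]
    refine Finset.sum_congr rfl fun k hk => ?_
    obtain ⟨m, hm, h2, hmL⟩ := hy k hk
    have h := dependsOn_flowedCloverEnergy_posEdges ρ (y k) hm h2 hmL (by omega) hUV
    simp only at h
    rw [h]
  have key := FariaDaVeigaOCarroll2022.integral_mul_timeReflect_nonneg ρ hL hρc hβ hFm hFb hFdep
  simp only [flowedCloverEnergy_timeReflect ρ hρu] at key
  exact key

/-- **SITE REFLECTION POSITIVITY FOR ENERGY DENSITIES** (even `L`, EVERY real `β`): for every finite real combination
`F = Σ_k c_k S_{y_k} − a` at sites of times `1 ≤ (y_k)₀ ≤ L/2 − 1`, `0 ≤ ∫ F · (Σ_k c_k S_{θ' y_k} − a) dμ_β`. -/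
theorem integral_sumEnergy_sub_mul_sum_negReflect_nonneg (hL : Even L) (hρc : Continuous ρ)
    (hρu : ∀ g, ρ g ∈ Matrix.unitaryGroup (Fin N) ℂ) (β : ℝ) {ι : Type*} (s : Finset ι) (c : ι → ℝ) (a : ℝ)
    (y : ι → Site 4 L) (hy : ∀ k ∈ s, ∃ m : ℕ, y k 0 = m ∧ 1 ≤ m ∧ m + 1 ≤ L / 2) :
    0 ≤ ∫ U, ((∑ k ∈ s, c k * flowedCloverEnergy ρ 0 (y k) U) - a) *
        ((∑ k ∈ s, c k * flowedCloverEnergy ρ 0 (Site.negReflect (y k)) U) - a) ∂(wilsonMeasure ρ β) := by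
  have hL1 : 1 < L := Fact.out
  obtain ⟨hFm, hFb⟩ := measurable_bounded_sum_energy_sub ρ hρc s c a y
  have hFdep : DependsOn (fun U : GaugeConfig 4 L G => (∑ k ∈ s, c k * flowedCloverEnergy ρ 0 (y k) U) - a)
      ((WilsonSiteRP.sitePosEdges ∪ WilsonSiteRP.sharedEdges : Finset (Edge 4 L)) : Set (Edge 4 L)) := by
    intro U V hUV
    simp only [sub_left_inj]
    refine Finset.sum_congr rfl fun k hk => ?_
    obtain ⟨m, hm, h1, hmL⟩ := hy k hk
    have h := dependsOn_flowedCloverEnergy_sitePosEdges ρ (y k) hm h1 hmL (by omega) hUV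
    simp only at h
    rw [h]
  have key := FariaDaVeigaOCarroll2022.integral_mul_negReflect_nonneg ρ hL hρc β hFm hFb hFdep
  simp only [flowedCloverEnergy_negReflect ρ hρu] at key
  exact key

/-- **`⟨(S_x − c)(S_{θx} − c)⟩_β ≥ 0`** for every real `c` (`2 ≤ x₀ ≤ L/2 − 1`, even `L`, `β ≥ 0`): a centred energy density
is non-negatively correlated with its link-reflected image. -/
theorem integral_energy_sub_mul_timeReflect_nonneg (hL : Even L) (hρc : Continuous ρ)
    (hρu : ∀ g, ρ g ∈ Matrix.unitaryGroup (Fin N) ℂ) {β : ℝ} (hβ : 0 ≤ β) (x : Site 4 L) {m : ℕ} (hx : x 0 = m)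
    (h2 : 2 ≤ m) (hm : m + 1 ≤ L / 2) (c : ℝ) :
    0 ≤ ∫ U, (flowedCloverEnergy ρ 0 x U - c) * (flowedCloverEnergy ρ 0 (Site.timeReflect x) U - c)
      ∂(wilsonMeasure ρ β) := by
  have h := integral_sumEnergy_sub_mul_sum_timeReflect_nonneg ρ hL hρc hρu hβ ({(0 : Unit)} : Finset Unit)
    (fun _ => 1) c (fun _ => x) (fun _ _ => ⟨m, hx, h2, hm⟩)
  simpa using h

/-- **`⟨(S_x − c)(S_{θ'x} − c)⟩_β ≥ 0`** for every real `c` (`1 ≤ x₀ ≤ L/2 − 1`, even `L`, every `β`). -/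
theorem integral_energy_sub_mul_negReflect_nonneg (hL : Even L) (hρc : Continuous ρ)
    (hρu : ∀ g, ρ g ∈ Matrix.unitaryGroup (Fin N) ℂ) (β : ℝ) (x : Site 4 L) {m : ℕ} (hx : x 0 = m) (h1 : 1 ≤ m)
    (hm : m + 1 ≤ L / 2) (c : ℝ) :
    0 ≤ ∫ U, (flowedCloverEnergy ρ 0 x U - c) * (flowedCloverEnergy ρ 0 (Site.negReflect x) U - c)
      ∂(wilsonMeasure ρ β) := by
  have h := integral_sumEnergy_sub_mul_sum_negReflect_nonneg ρ hL hρc hρu β ({(0 : Unit)} : Finset Unit)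
    (fun _ => 1) c (fun _ => x) (fun _ _ => ⟨m, hx, h1, hm⟩)
  simpa using h

/-! ## §3 Slab energies -/

/-- **THE CENTRED SLAB-ENERGY CORRELATOR ACROSS THE LINK PLANE IS NON-NEGATIVE**: with `E_t = Σ_{x : x₀ = t} S_x`,
`⟨(E_m − c)(E_{1−m} − c)⟩_β ≥ 0` for every real `c`, `2 ≤ m ≤ L/2 − 1`, even `L`, `β ≥ 0`. -/
theorem integral_slabEnergy_sub_mul_timeReflect_nonneg (hL : Even L) (hρc : Continuous ρ)
    (hρu : ∀ g, ρ g ∈ Matrix.unitaryGroup (Fin N) ℂ) {β : ℝ} (hβ : 0 ≤ β) {m : ℕ} (h2 : 2 ≤ m) (hm : m + 1 ≤ L / 2)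
    (c : ℝ) :
    0 ≤ ∫ U, ((∑ x ∈ Finset.univ.filter (fun x : Site 4 L => x 0 = (m : ZMod L)), flowedCloverEnergy ρ 0 x U) - c) *
        ((∑ x ∈ Finset.univ.filter (fun x : Site 4 L => x 0 = 1 - (m : ZMod L)), flowedCloverEnergy ρ 0 x U) - c)
      ∂(wilsonMeasure ρ β) := by
  have h := integral_sumEnergy_sub_mul_sum_timeReflect_nonneg ρ hL hρc hρu hβ
    (Finset.univ.filter (fun x : Site 4 L => x 0 = (m : ZMod L))) (fun _ => 1) c id
    (fun x hx => ⟨m, by simpa using hx, h2, hm⟩)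
  simp only [id, one_mul] at h
  have hre : ∀ U : GaugeConfig 4 L G,
      ∑ x ∈ Finset.univ.filter (fun x : Site 4 L => x 0 = (m : ZMod L)), flowedCloverEnergy ρ 0 (Site.timeReflect x) U =
        ∑ x ∈ Finset.univ.filter (fun x : Site 4 L => x 0 = 1 - (m : ZMod L)), flowedCloverEnergy ρ 0 x U := fun U =>
    sum_slab_timeReflect (m : ZMod L) (fun x => flowedCloverEnergy ρ 0 x U)
  simp only [hre] at h
  exact h

/-- **THE CENTRED SLAB-ENERGY CORRELATOR ACROSS THE SITE PLANE IS NON-NEGATIVE**: `⟨(E_m − c)(E_{−m} − c)⟩_β ≥ 0` for every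
real `c`, `1 ≤ m ≤ L/2 − 1`, even `L`, every `β`. -/
theorem integral_slabEnergy_sub_mul_negReflect_nonneg (hL : Even L) (hρc : Continuous ρ)
    (hρu : ∀ g, ρ g ∈ Matrix.unitaryGroup (Fin N) ℂ) (β : ℝ) {m : ℕ} (h1 : 1 ≤ m) (hm : m + 1 ≤ L / 2) (c : ℝ) :
    0 ≤ ∫ U, ((∑ x ∈ Finset.univ.filter (fun x : Site 4 L => x 0 = (m : ZMod L)), flowedCloverEnergy ρ 0 x U) - c) *
        ((∑ x ∈ Finset.univ.filter (fun x : Site 4 L => x 0 = -(m : ZMod L)), flowedCloverEnergy ρ 0 x U) - c)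
      ∂(wilsonMeasure ρ β) := by
  have h := integral_sumEnergy_sub_mul_sum_negReflect_nonneg ρ hL hρc hρu β
    (Finset.univ.filter (fun x : Site 4 L => x 0 = (m : ZMod L))) (fun _ => 1) c id
    (fun x hx => ⟨m, by simpa using hx, h1, hm⟩)
  simp only [id, one_mul] at h
  have hre : ∀ U : GaugeConfig 4 L G,
      ∑ x ∈ Finset.univ.filter (fun x : Site 4 L => x 0 = (m : ZMod L)), flowedCloverEnergy ρ 0 (Site.negReflect x) U =
        ∑ x ∈ Finset.univ.filter (fun x : Site 4 L => x 0 = -(m : ZMod L)), flowedCloverEnergy ρ 0 x U := fun U =>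
    sum_slab_negReflect (m : ZMod L) (fun x => flowedCloverEnergy ρ 0 x U)
  simp only [hre] at h
  exact h

/-! ## §4 The Schwarz inequality: the connected slab-energy correlator is midpoint log-convex across the planes -/

omit [IsTopologicalGroup G] in
/-- The centred slab energy `E_m − c` (`2 ≤ m ≤ L/2 − 1`) is measurable, bounded and an observable of the positive-time links. -/
theorem slabEnergy_sub_admissible_link (hρc : Continuous ρ) {m : ℕ} (h2 : 2 ≤ m) (hm : m + 1 ≤ L / 2) (c : ℝ) :
    Measurable (fun U : GaugeConfig 4 L G =>
        (∑ x ∈ Finset.univ.filter (fun x : Site 4 L => x 0 = (m : ZMod L)), flowedCloverEnergy ρ 0 x U) - c) ∧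
      (∃ K : ℝ, ∀ U : GaugeConfig 4 L G,
        |(∑ x ∈ Finset.univ.filter (fun x : Site 4 L => x 0 = (m : ZMod L)), flowedCloverEnergy ρ 0 x U) - c| ≤ K) ∧
      DependsOn (fun U : GaugeConfig 4 L G =>
        (∑ x ∈ Finset.univ.filter (fun x : Site 4 L => x 0 = (m : ZMod L)), flowedCloverEnergy ρ 0 x U) - c)
        {e : Edge 4 L | WilsonRP.IsPosEdge e} := by
  have hL1 : 1 < L := Fact.out
  obtain ⟨hFm, hFb⟩ := measurable_bounded_sum_energy_sub ρ hρc
    (Finset.univ.filter (fun x : Site 4 L => x 0 = (m : ZMod L))) (fun _ => (1 : ℝ)) c id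
  simp only [id, one_mul] at hFm hFb
  refine ⟨hFm, hFb, fun U V hUV => ?_⟩
  simp only [sub_left_inj]
  refine Finset.sum_congr rfl fun x hx => ?_
  have hx0 : x 0 = (m : ZMod L) := by simpa using hx
  have h := dependsOn_flowedCloverEnergy_posEdges ρ x hx0 h2 hm (by omega) hUV
  simpa using h

omit [IsTopologicalGroup G] in
/-- The centred slab energy `E_m − c` (`1 ≤ m ≤ L/2 − 1`) is measurable, bounded and an observable of the site-positive and
shared links. -/
theorem slabEnergy_sub_admissible_site (hρc : Continuous ρ) {m : ℕ} (h1 : 1 ≤ m) (hm : m + 1 ≤ L / 2) (c : ℝ) :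
    Measurable (fun U : GaugeConfig 4 L G =>
        (∑ x ∈ Finset.univ.filter (fun x : Site 4 L => x 0 = (m : ZMod L)), flowedCloverEnergy ρ 0 x U) - c) ∧
      (∃ K : ℝ, ∀ U : GaugeConfig 4 L G,
        |(∑ x ∈ Finset.univ.filter (fun x : Site 4 L => x 0 = (m : ZMod L)), flowedCloverEnergy ρ 0 x U) - c| ≤ K) ∧
      DependsOn (fun U : GaugeConfig 4 L G =>
        (∑ x ∈ Finset.univ.filter (fun x : Site 4 L => x 0 = (m : ZMod L)), flowedCloverEnergy ρ 0 x U) - c)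
        ((WilsonSiteRP.sitePosEdges ∪ WilsonSiteRP.sharedEdges : Finset (Edge 4 L)) : Set (Edge 4 L)) := by
  have hL1 : 1 < L := Fact.out
  obtain ⟨hFm, hFb⟩ := measurable_bounded_sum_energy_sub ρ hρc
    (Finset.univ.filter (fun x : Site 4 L => x 0 = (m : ZMod L))) (fun _ => (1 : ℝ)) c id
  simp only [id, one_mul] at hFm hFb
  refine ⟨hFm, hFb, fun U V hUV => ?_⟩
  simp only [sub_left_inj]
  refine Finset.sum_congr rfl fun x hx => ?_
  have hx0 : x 0 = (m : ZMod L) := by simpa using hx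
  have h := dependsOn_flowedCloverEnergy_sitePosEdges ρ x hx0 h1 hm (by omega) hUV
  simpa using h

/-- **SCHWARZ ACROSS THE LINK PLANE FOR CENTRED SLAB ENERGIES**: for every real `c`, `β ≥ 0`, even `L`, `2 ≤ m, m' ≤ L/2 − 1`,
`(∫ (E_m − c)(E_{1−m'} − c))² ≤ (∫ (E_m − c)(E_{1−m} − c))·(∫ (E_{m'} − c)(E_{1−m'} − c))` — with `c = ⟨E⟩` the connected
slab-energy correlator is midpoint log-convex along the odd separations. -/
theorem sq_integral_slabEnergy_sub_timeReflect_le (hL : Even L) (hρc : Continuous ρ)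
    (hρu : ∀ g, ρ g ∈ Matrix.unitaryGroup (Fin N) ℂ) {β : ℝ} (hβ : 0 ≤ β) {m m' : ℕ} (h2 : 2 ≤ m) (hm : m + 1 ≤ L / 2)
    (h2' : 2 ≤ m') (hm' : m' + 1 ≤ L / 2) (c : ℝ) :
    (∫ U, ((∑ x ∈ Finset.univ.filter (fun x : Site 4 L => x 0 = (m : ZMod L)), flowedCloverEnergy ρ 0 x U) - c) *
        ((∑ x ∈ Finset.univ.filter (fun x : Site 4 L => x 0 = 1 - (m' : ZMod L)), flowedCloverEnergy ρ 0 x U) - c)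
        ∂(wilsonMeasure ρ β)) ^ 2 ≤
      (∫ U, ((∑ x ∈ Finset.univ.filter (fun x : Site 4 L => x 0 = (m : ZMod L)), flowedCloverEnergy ρ 0 x U) - c) *
          ((∑ x ∈ Finset.univ.filter (fun x : Site 4 L => x 0 = 1 - (m : ZMod L)), flowedCloverEnergy ρ 0 x U) - c)
          ∂(wilsonMeasure ρ β)) *
        (∫ U, ((∑ x ∈ Finset.univ.filter (fun x : Site 4 L => x 0 = (m' : ZMod L)), flowedCloverEnergy ρ 0 x U) - c) *
          ((∑ x ∈ Finset.univ.filter (fun x : Site 4 L => x 0 = 1 - (m' : ZMod L)), flowedCloverEnergy ρ 0 x U) - c)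
          ∂(wilsonMeasure ρ β)) := by
  haveI := isProbabilityMeasure_wilsonMeasure (d := 4) (L := L) ρ hρc β
  obtain ⟨hAm, hAb, hA⟩ := slabEnergy_sub_admissible_link ρ hρc h2 hm c
  obtain ⟨hBm, hBb, hB⟩ := slabEnergy_sub_admissible_link ρ hρc h2' hm' c
  have hadm : ∀ (A B : GaugeConfig 4 L G → ℝ) (t : ℝ), DependsOn A {e : Edge 4 L | WilsonRP.IsPosEdge e} →
      DependsOn B {e : Edge 4 L | WilsonRP.IsPosEdge e} →
      DependsOn (fun U => A U + t * B U) {e : Edge 4 L | WilsonRP.IsPosEdge e} :=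
    fun A B t hA hB U V hUV => by simp only [hA hUV, hB hUV]
  have key := FariaDaVeigaOCarroll2022.MultiReflection.sq_integral_mul_comp_le_of_rp (μ := wilsonMeasure ρ β)
    FariaDaVeigaOCarroll2022.timeReflectEquiv (FariaDaVeigaOCarroll2022.measurePreserving_timeReflectEquiv ρ hρc β)
    (fun U => (FariaDaVeigaOCarroll2022.timeReflectEquiv (d := 4) (L := L) (G := G)).left_inv U)
    (fun F => DependsOn F {e : Edge 4 L | WilsonRP.IsPosEdge e}) hadm
    (fun F hF hFm hFb => FariaDaVeigaOCarroll2022.integral_mul_timeReflect_nonneg ρ hL hρc hβ hFm hFb hF)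
    hA hB hAm hBm hAb hBb
  have happ : ∀ U : GaugeConfig 4 L G,
      (FariaDaVeigaOCarroll2022.timeReflectEquiv : GaugeConfig 4 L G ≃ᵐ GaugeConfig 4 L G) U = U.timeReflect :=
    fun U => rfl
  have hre : ∀ (k : ℕ) (U : GaugeConfig 4 L G),
      ∑ x ∈ Finset.univ.filter (fun x : Site 4 L => x 0 = (k : ZMod L)),
          flowedCloverEnergy ρ 0 x (FariaDaVeigaOCarroll2022.timeReflectEquiv U) =
        ∑ x ∈ Finset.univ.filter (fun x : Site 4 L => x 0 = 1 - (k : ZMod L)), flowedCloverEnergy ρ 0 x U := by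
    intro k U
    rw [happ, ← sum_slab_timeReflect (k : ZMod L) (fun x => flowedCloverEnergy ρ 0 x U)]
    exact Finset.sum_congr rfl fun x _ => flowedCloverEnergy_timeReflect ρ hρu U x
  simp only [hre] at key
  exact key

/-- **SCHWARZ ACROSS THE SITE PLANE FOR CENTRED SLAB ENERGIES**: for every real `c`, every `β`, even `L`,
`1 ≤ m, m' ≤ L/2 − 1`, `(∫ (E_m − c)(E_{−m'} − c))² ≤ (∫ (E_m − c)(E_{−m} − c))·(∫ (E_{m'} − c)(E_{−m'} − c))`. -/
theorem sq_integral_slabEnergy_sub_negReflect_le (hL : Even L) (hρc : Continuous ρ)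
    (hρu : ∀ g, ρ g ∈ Matrix.unitaryGroup (Fin N) ℂ) (β : ℝ) {m m' : ℕ} (h1 : 1 ≤ m) (hm : m + 1 ≤ L / 2)
    (h1' : 1 ≤ m') (hm' : m' + 1 ≤ L / 2) (c : ℝ) :
    (∫ U, ((∑ x ∈ Finset.univ.filter (fun x : Site 4 L => x 0 = (m : ZMod L)), flowedCloverEnergy ρ 0 x U) - c) *
        ((∑ x ∈ Finset.univ.filter (fun x : Site 4 L => x 0 = -(m' : ZMod L)), flowedCloverEnergy ρ 0 x U) - c)
        ∂(wilsonMeasure ρ β)) ^ 2 ≤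
      (∫ U, ((∑ x ∈ Finset.univ.filter (fun x : Site 4 L => x 0 = (m : ZMod L)), flowedCloverEnergy ρ 0 x U) - c) *
          ((∑ x ∈ Finset.univ.filter (fun x : Site 4 L => x 0 = -(m : ZMod L)), flowedCloverEnergy ρ 0 x U) - c)
          ∂(wilsonMeasure ρ β)) *
        (∫ U, ((∑ x ∈ Finset.univ.filter (fun x : Site 4 L => x 0 = (m' : ZMod L)), flowedCloverEnergy ρ 0 x U) - c) *
          ((∑ x ∈ Finset.univ.filter (fun x : Site 4 L => x 0 = -(m' : ZMod L)), flowedCloverEnergy ρ 0 x U) - c)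
          ∂(wilsonMeasure ρ β)) := by
  haveI := isProbabilityMeasure_wilsonMeasure (d := 4) (L := L) ρ hρc β
  obtain ⟨hAm, hAb, hA⟩ := slabEnergy_sub_admissible_site ρ hρc h1 hm c
  obtain ⟨hBm, hBb, hB⟩ := slabEnergy_sub_admissible_site ρ hρc h1' hm' c
  have hadm : ∀ (A B : GaugeConfig 4 L G → ℝ) (t : ℝ),
      DependsOn A ((WilsonSiteRP.sitePosEdges ∪ WilsonSiteRP.sharedEdges : Finset (Edge 4 L)) : Set (Edge 4 L)) →
      DependsOn B ((WilsonSiteRP.sitePosEdges ∪ WilsonSiteRP.sharedEdges : Finset (Edge 4 L)) : Set (Edge 4 L)) →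
      DependsOn (fun U => A U + t * B U)
        ((WilsonSiteRP.sitePosEdges ∪ WilsonSiteRP.sharedEdges : Finset (Edge 4 L)) : Set (Edge 4 L)) :=
    fun A B t hA hB U V hUV => by simp only [hA hUV, hB hUV]
  have key := FariaDaVeigaOCarroll2022.MultiReflection.sq_integral_mul_comp_le_of_rp (μ := wilsonMeasure ρ β)
    WilsonSiteRP.negReflectEquiv (FariaDaVeigaOCarroll2022.measurePreserving_negReflectEquiv ρ hL hρc β)
    (fun U => (WilsonSiteRP.negReflectEquiv (d := 4) (L := L) (G := G)).left_inv U)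
    (fun F => DependsOn F ((WilsonSiteRP.sitePosEdges ∪ WilsonSiteRP.sharedEdges : Finset (Edge 4 L)) : Set (Edge 4 L)))
    hadm (fun F hF hFm hFb => FariaDaVeigaOCarroll2022.integral_mul_negReflect_nonneg ρ hL hρc β hFm hFb hF)
    hA hB hAm hBm hAb hBb
  have happ : ∀ U : GaugeConfig 4 L G,
      (WilsonSiteRP.negReflectEquiv : GaugeConfig 4 L G ≃ᵐ GaugeConfig 4 L G) U = U.negReflect := fun U => rfl
  have hre : ∀ (k : ℕ) (U : GaugeConfig 4 L G),
      ∑ x ∈ Finset.univ.filter (fun x : Site 4 L => x 0 = (k : ZMod L)),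
          flowedCloverEnergy ρ 0 x (WilsonSiteRP.negReflectEquiv U) =
        ∑ x ∈ Finset.univ.filter (fun x : Site 4 L => x 0 = -(k : ZMod L)), flowedCloverEnergy ρ 0 x U := by
    intro k U
    rw [happ, ← sum_slab_negReflect (k : ZMod L) (fun x => flowedCloverEnergy ρ 0 x U)]
    exact Finset.sum_congr rfl fun x _ => flowedCloverEnergy_negReflect ρ hρu U x
  simp only [hre] at key
  exact key

end Positivity

end Summit.Ventures.LatticeQCDFlow.Exactness
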